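import Summits.QuantumFields.BalabanUV.T4Continuum.Support.NE7EnergyRateWPrep
import HarnessLib

/-!
# NE7EnergyRateWSU2 — NODE NE3's RE-TYPED ROOT T-E_w♯ (`NE3EnergyWeightedSupShape.NE3EnergyRateWSup`) FOR SU(2), d = 4, L = 2, WITH NO DISPLAYED HYPOTHESIS: for `0 < ε ≤ ε₀`,
# regularity data `0 ≤ b`, `b + 10⁸b² ≤ ε`, `0 < g`, there are k-free, N-free `C, s ≥ 0` such that for EVERY period `N`, EVERY data class, EVERY level `k ≥ 1` and EVERY pair of
# minimisers `U_A` (level `k`), `U_B` (level `k+1`, `Regular b g`) over a common datum: a periodic unitary gauge `u` and a skew periodic `Z` with `U_A^{u} = (cavg U_B)·e^{Z}`,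
# `‖Z‖_w ≤ C·residualScale 4 2 N b g k` and `‖Z(b)‖ ≤ s·2^{−k}` — the η-RATE of the block-averaged finer minimiser against the coarser one, in the weighted energy norm

Cell `pub-balaban`, rung (B)+1 sub-cell t4, lineage `b2b-balaban-t4-ne7-p1`, generation 105 (CRUX PROVER NE7 #1 = OWNER of BINDER row NE7).  Memo `t4/b2b-balaban-t4-ne7-p1-g105/ROAD-G105.md`.
THE ARGUMENT (energy convexity at the APPROXIMATELY critical background, memo §3).  `W := cavg 2 U_B` is an admissible competitor of `U_A`'s problem (`prop1Radius`, the line `b + 10⁸b² ≤ ε`),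
so `A(U_A) ≤ A(W)`.  Gen 105's pair decomposition `NE7PairDecompNL0.decomp_of_nl0_pair` (the (R1″) slice theorem of gens 102–104 for an arbitrary admissible pair) gives a periodic unitary
`u` with `U_A^{u} = W·e^{X}`, `X = X_T + X_N`, `X_T ∈ 𝒯_E(W)`, `M·sup‖X‖ ≤ C_Sε`, `‖X_N‖_w ≤ ν‖X‖_w`, `(ε∕M²)Σ‖curl X_N‖ ≤ κ‖X‖_w²`, `ν, κ = O(ε)`, `‖framePotW X_T‖ ≤ frameC·C_Sε`.
Along the segment `W·e^{tX}` the Wilson Hessian is `≥ c_k‖X‖_w²` (`NE7ConvOneStepWeighted.curlSq_ge_weighted ∕ hess_vary_ge_weighted` over gen 99's class slice-Poincaré inequality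
`classSlicePoincare_energyBlockLandau_SU2`), so Taylor (`T4ConvexResponse.taylor_lower`) and minimality give `dAction W X + c_k‖X‖_w²∕2 ≤ A(U_A) − A(W) ≤ 0`.  The first variation splits:
`|dAction W X_N| ≤ κ‖X‖_w²` (the curl letter), and `|dAction W X_T| ≤ r·(‖X_T‖_w + ‖S‖_w)` by ROW NE3's KERNEL (RES♯) transferred to the slice (`NE7EnergySliceSpikeResidual`, `r = C′·residualScale`,
`S` the corner spike, `‖S‖_w ≤ √(4·#Plane+16)·N²·frameC·C_Sε∕M`).  Hence `(c_k∕2 − κ)‖X‖_w² ≤ r(1+ν)‖X‖_w + r‖S‖_w`; the k-free strict line of gen 104 (`line_of_small`) makes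
`c_k∕2 − κ ≥ γ(ε) > 0` uniformly in `k` (`NE7RepWGaugeOfRoutePi.exp_term_le_of_currency`), and `residualScale ≥ wallConst·dualC2·√g·N²∕(2M)` absorbs the additive spike term:
`‖X‖_w ≤ C·residualScale` with `C = C′(1+ν̂)∕γ + √(2C′·√(4·#Plane+16)·frameC·C_Sε ∕ (γ·wallConst 4 2·dualC2 4 2·√g))`.
WHAT ([folklore]; 0 def, 0 sorry; the positivity ∕ admissibility ∕ k-free-coercivity ∕ real-arithmetic lemmas are in `NE7EnergyRateWPrep`).  **`ne3EnergyRateWSup_SU2`**: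
`card n = 2 → ∃ ε₀ > 0, ∀ 0 < ε ≤ ε₀, ∀ b g, 0 ≤ b → b + 10⁸b² ≤ ε → 0 < g → ∃ C s ≥ 0, ∀ N ≥ 1, ∀ dom, NE3EnergyRateWSup 4 (sfClass 4 2 N ε) 2 N b g C s dom`.
HONEST FRAMING (page 1): composition of landed kernel theorems of rows NE3 (swarm leaf-01∕02, NE3-R2: the deficit wall, (RES♯)) and NE7 (gens 93–105) and of [B7]∕[B8]∕[B11] AS TYPED in the tree;
nothing of Bałaban's asserted as an axiom; constants existential (no numerical value claimed); SU(2) (`card n = 2`, `n : Type`), `L = 2`, finite 4-torus only.  This is node NE3's ROOT in the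
weighted reading (T-E_w♯ ⟹ T-E_w, `NE3EnergyWeightedSupShape.ne3EnergyRateW_of_sup`); it is NOT the unweighted T-E, NOT the covariant-Lipschitz conjuncts (Lip₁ᶜ)(Lip₂′ᶜ) of route 1's socket
`h`, NOT NE7; spine count = dagwriter∕referees' call; NOT infinite volume, NOT mass gap, NOT BetaPertH, NOT Clay (continuum YM on T⁴ ⇐ BetaPertH ∧ nine spine estimates).
-/

set_option autoImplicit false

open scoped BigOperators Matrix Matrix.Norms.L2Operator
open NormedSpace Finset Set

namespace Summit.QuantumFields.BalabanUV.T4Continuum.NE7EnergyRateWSU2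

open Literature.MathematicalPhysics.QuantumFieldTheory.Balaban1983to89
open B7Prop1Explicit B7Prop2Explicit
open T4AveragingDeficitWall (IsUnitaryCfg IsSkewDir SmallField fineAction vary curl curlSq dirSq)
open T4AveragingDeficitWallBoundary (IsPeriodicCfg periodBox)
open T4ConvexResponse (taylor_lower)
open AveragingDeficitPeriodicCounting (IsPeriodicDir)
open AveragingDeficitDerivWallProof (wallConst wallConst_nonneg)
open AveragingDeficitCoreAxial (coreC_nonneg)
open AveragingDeficitDualResidual (dualC2 dualC1)
open AveragingDeficitChartCalculus (cavg)
open AveragingDeficitTwoLevelPrep (prop1Radius smallField_cavg)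
open AveragingDeficitFermat (isPeriodicCfg_cavg)
open AveragingDeficitMultiLevelPrep (LevelSmall tower)
open AveragingDeficitMultiLevelBridge (cavg_eq_rescale_bavg)
open MinimalActionLevels (perWin levelAction avgIter_rescale_bavg stepWt_pos)
open MinimalActionSandwich (IsMinimiser admissible)
open MinimalActionRate (sfClass Regular)
open NE3HessForm (dAction hess segment_derivData)
open NE3SlicePoincareBudgetLine (CPLine)
open NE3ClassRadiusFamily (CPLine_nonneg_d4_L2)
open NE3EnergyShapes (IsUnitarySite IsPeriodicSite residualScale residualScale_nonneg dualC1_nonneg dualC2_nonneg)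
open NE3EnergyWeightedShapes (energyNormW energyNormW_nonneg)
open NE3EnergyWeightedSupShape (NE3EnergyRateWSup)
open NE3WeightedCoercivityTransfer (energyNormW_sq)
open NE3ProductPathBounds (energyNormW_sub_le)
open NE3EnergyChartLeaves (isUnitaryCfg_cavg_of_regular)
open NE3RightInverseSupLetters (frameC)
open NE3AxialGaugeLadder (smallField_gaugeAct)
open NE7MeanZeroGaugeSliceW (energyBlockLandauW)
open NE7EnergyBlockLandauClassPoincare (classSlicePoincare_energyBlockLandau_SU2)
open NE7ConvOneStepSU2 (levelSmall_all_d4_L2)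
open NE7ConvOneStepWeighted (curlSq_ge_weighted hess_vary_ge_weighted)
open NE7SegmentPlaquetteRadius (smallField_vary_segment_class)
open NE7OneStepLetters (abs_dAction_le_radius_mul)
open NE7ExactCurrent (dAction_add)
open NE7EtaMinimiserGaugeCovariance (levelAction_gaugeAct)
open NE7RepWGaugeOfRoutePi (exp_term_le_of_currency)
open NE7HintUnconditionalSU2 (line_of_small)
open NE7PairDecompNL0 (decomp_of_nl0_pair)
open NE7EnergySliceSpikeResidual (energyNormW_spike_sq_le spike_tangent_data abs_dAction_le_of_regular_slice)
open BlockAveragePushDirGauge (gaugeDir)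
open NE3CornerSpikes (spikeW)
open NE3TangentCovariantTower (framePotW)

open NE7EnergyRateWPrep

noncomputable section

/-! ## T-E_w♯ for SU(2), d = 4, L = 2 -/

set_option maxHeartbeats 800000 in
/-- **NODE NE3's RE-TYPED ROOT T-E_w♯ FOR SU(2), `d = 4`, `L = 2`, NO DISPLAYED HYPOTHESIS** (statement and argument in the file header). [folklore] -/
theorem ne3EnergyRateWSup_SU2 {n : Type} [Fintype n] [DecidableEq n] [Nonempty n] (hn : Fintype.card n = 2) :
    ∃ ε₀ : ℝ, 0 < ε₀ ∧ ∀ ε : ℝ, 0 < ε → ε ≤ ε₀ → ∀ b g : ℝ, 0 ≤ b → b + 10 ^ 8 * b ^ 2 ≤ ε → 0 < g →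
      ∃ C s : ℝ, 0 ≤ C ∧ 0 ≤ s ∧ ∀ (N : ℕ) [NeZero N] (dom : Set (Site 4 → Fin 4 → (Matrix n n ℂ)ˣ)),
        NE3EnergyRateWSup 4 (sfClass 4 2 N ε) 2 N b g C s dom := by
  obtain ⟨ε₂, hε₂, CS, hCS, νc, hνc, κc, hκc, hdec⟩ := decomp_of_nl0_pair (n := n)
  -- the k-free coercivity budget of gen 104 (`line_of_small`), Poincaré constant `CP = 8·CPLine + 1`
  obtain ⟨CP, hCP⟩ : ∃ CP : ℝ, CP = 8 * CPLine 4 2 2 (1 / 10 ^ 17) (1 / 10 ^ 53) + 1 := ⟨_, rfl⟩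
  have hCP1 : 1 ≤ CP := by rw [hCP]; have := CPLine_nonneg_d4_L2; linarith
  have hCP0 : 0 ≤ CP := by linarith
  obtain ⟨Q, hQ⟩ : ∃ Q : ℝ, Q = 2 * (1 + CP) := ⟨_, rfl⟩
  have hQ4 : 4 ≤ Q := by rw [hQ]; linarith
  have hQ0 : 0 < Q := by linarith
  obtain ⟨cL, hcL⟩ : ∃ cL : ℝ, cL = 2 * κc + νc ^ 2 + 2304 * (CS ^ 2 * Real.exp (2 * CS)) + 112 * (1 + 7 * CS ^ 2) + 1 := ⟨_, rfl⟩
  have hcL0 : 0 < cL := by rw [hcL]; positivity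
  obtain ⟨ε₃, hε₃⟩ : ∃ ε₃ : ℝ, ε₃ = (1 / 2) / Q / 4 / cL := ⟨_, rfl⟩
  have hε₃0 : 0 < ε₃ := by rw [hε₃]; positivity
  have hcard : (0 : ℝ) < 1000000000000000000000 * (Fintype.card n : ℝ) := by rw [hn]; norm_num
  refine ⟨min ε₂ (min (1 / 10 ^ 53) (min (1 / (1000000000000000000000 * (Fintype.card n : ℝ))) (min ε₃ 1))),
    lt_min hε₂ (lt_min (by norm_num) (lt_min (by positivity) (lt_min hε₃0 one_pos))), ?_⟩
  intro ε hε hεle b g hb hbq hg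
  have hεε₂ : ε ≤ ε₂ := hεle.trans (min_le_left _ _)
  have hε53 : ε ≤ 1 / 10 ^ 53 := hεle.trans ((min_le_right _ _).trans (min_le_left _ _))
  have hεθ : ε ≤ 1 / (1000000000000000000000 * (Fintype.card n : ℝ)) :=
    hεle.trans ((min_le_right _ _).trans ((min_le_right _ _).trans (min_le_left _ _)))
  have hεε₃ : ε ≤ ε₃ := hεle.trans ((min_le_right _ _).trans ((min_le_right _ _).trans ((min_le_right _ _).trans (min_le_left _ _))))
  have hε1 : ε ≤ 1 := hεle.trans ((min_le_right _ _).trans ((min_le_right _ _).trans ((min_le_right _ _).trans (min_le_right _ _))))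
  have hε11 : ε ≤ 1 / 10 ^ 11 := hε53.trans (by norm_num)
  have hθline : 1000000000000000000000 * (Fintype.card n : ℝ) * ε ≤ 1 := by
    rw [le_div_iff₀ hcard] at hεθ; linarith
  -- the strict line: `2κ_c ε < cK`, i.e. the gap `γ := cK/2 − κ_c ε > 0`
  have hsmall : cL * ε ≤ (1 / 2) / Q / 4 := by
    have h1 : cL * ε ≤ cL * ε₃ := mul_le_mul_of_nonneg_left hεε₃ hcL0.le
    have h2 : cL * ε₃ = (1 / 2) / Q / 4 := by rw [hε₃]; field_simp
    linarith only [h1, h2]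
  have hline := line_of_small hQ4 hCS hε hε1 (by rw [← hcL]; exact hsmall)
  obtain ⟨cK, hcK⟩ : ∃ cK : ℝ, cK = ((((1 / 2 - (νc * ε) ^ 2) / Q - (νc * ε) ^ 2) / 2 - 576 * ((4 : ℕ) : ℝ) * ((CS * ε) ^ 2 * Real.exp (2 * (CS * ε)))) / ((2 : ℕ) : ℝ)
      - 28 * ((4 : ℕ) : ℝ) * (ε + 7 * (CS * ε) ^ 2)) := ⟨_, rfl⟩
  rw [← hcK] at hline
  obtain ⟨γ, hγ⟩ : ∃ γ : ℝ, γ = cK / 2 - κc * ε := ⟨_, rfl⟩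
  have hγ0 : 0 < γ := by rw [hγ]; linarith
  -- the constants of the bound
  obtain ⟨C', hC'⟩ : ∃ C' : ℝ, C' = (Real.sqrt (((2 : ℕ) : ℝ) ^ (4 - 2))
            + (Real.sqrt (((2 : ℕ) : ℝ) ^ (4 - 2)) * Real.sqrt (8 * Fintype.card (T4AveragingDeficitWall.Plane 4))
                * (128 * ((4 : ℕ) * ((2 : ℕ) : ℝ) ^ 2))
              + 2 * (2048 * (((4 : ℕ) : ℝ) + 4) ^ 2 * ((2 : ℕ) : ℝ) ^ 2 * Real.sqrt ((4 : ℕ) * ((2 : ℕ) : ℝ) ^ 4))) * b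
            + b ^ 2 * (2 * ((2 : ℕ) : ℝ) ^ (4 - 1) + 2 * (8 * (4 : ℕ) * ((2 : ℕ) : ℝ) ^ 4)) * Real.sqrt ((4 : ℕ) / (g * ((2 : ℕ) : ℝ) ^ (4 + 2)))) := ⟨_, rfl⟩
  have hC'0 : 0 ≤ C' := by rw [hC']; positivity
  obtain ⟨G, hG⟩ : ∃ G : ℝ, G = frameC 4 2 * (CS * ε) := ⟨_, rfl⟩
  have hG0 : 0 ≤ G := by rw [hG]; have := NE7FrameFreeRightInverse.frameC_nonneg 4 2; positivity
  obtain ⟨σ, hσ⟩ : ∃ σ : ℝ, σ = Real.sqrt (4 * (Fintype.card (T4AveragingDeficitWall.Plane 4) : ℝ) + 16) * G := ⟨_, rfl⟩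
  have hσ0 : 0 ≤ σ := by rw [hσ]; positivity
  obtain ⟨w₀, hw₀⟩ : ∃ w₀ : ℝ, w₀ = wallConst 4 2 * dualC2 4 2 * Real.sqrt g := ⟨_, rfl⟩
  have hw₀0 : 0 < w₀ := by rw [hw₀]; exact mul_pos (mul_pos (wallConst_pos 4 2) dualC2_pos_d4) (Real.sqrt_pos.2 hg)
  obtain ⟨Cfin, hCfin⟩ : ∃ Cfin : ℝ, Cfin = C' * (1 + νc * ε) / γ + Real.sqrt (2 * C' * σ / (γ * w₀)) := ⟨_, rfl⟩
  refine ⟨Cfin, CS * ε, by rw [hCfin]; positivity, by positivity, ?_⟩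
  intro N _ dom k hk V _ UA UB hA hB hreg
  have hN : 1 ≤ N := Nat.one_le_iff_ne_zero.mpr (NeZero.ne N)
  obtain ⟨j, rfl⟩ : ∃ j, k = j + 1 := ⟨k - 1, by omega⟩
  have hB' : IsMinimiser 4 (sfClass 4 2 N ε) 2 N (j + 2) V UB := hB
  have hreg' : Regular 4 2 N b g (j + 2) UB := hreg
  -- the competitor `W := cavg 2 U_B` and its class data
  obtain ⟨hbε, hs1, hs2, hWu, hWP, hWx, hWadm⟩ := cavg_admissible_d4 (N := N) j hε hε11 hb hbq hB' hreg'
  have htow : ((tower 2 N (j + 1) : ℕ) : ℤ) = ((N * 2 ^ (j + 1) : ℕ) : ℤ) := by rw [NE3EnergyRateWSupOfSlicePoincare.tower_eq_mul_pow]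
  have hWPt : IsPeriodicCfg (cavg 2 UB) ((tower 2 N (j + 1) : ℕ) : ℤ) := by rw [htow]; exact hWP
  have hM0 : (0 : ℝ) < ((2 : ℕ) : ℝ) ^ (j + 1) := by positivity
  have hM1 : (1 : ℝ) ≤ ((2 : ℕ) : ℝ) ^ (j + 1) := one_le_pow₀ (by norm_num)
  have hx : 0 ≤ ε / (((2 : ℕ) : ℝ) ^ (j + 1)) ^ 2 := by positivity
  -- the pair decomposition in the slice gauge
  obtain ⟨u, X, XT, XN, α, ν, κ, hu, huP, hXs, hXP, hα, hXα, hgauge, hXdec, hXT, hframe, hXN, hν, hNw, hN1, hαM, hνle, hκle⟩ :=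
    hdec N ε hε hεε₂ hθline V j (cavg 2 UB) hWadm UA hA.mem
  have hE0 := energyNormW_nonneg 2 (j + 1) (cavg 2 UB) X (periodBox (d := 4) (N * 2 ^ (j + 1)))
  -- (1) the weighted Poincaré letter on the class (constant `8·CPLine ≤ CP`)
  have hP0 := classSlicePoincare_energyBlockLandau_SU2 (n := n) hn hN hε hε53 j (cavg 2 UB) ⟨hWu, hWP, hWx⟩
  have hP := NE3SlicePoincareShape.slicePoincare_mono hP0 (show 8 * CPLine 4 2 2 (1 / 10 ^ 17) (1 / 10 ^ 53) ≤ CP by rw [hCP]; linarith)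
  have hNw2 : energyNormW 2 (j + 1) (cavg 2 UB) XN (periodBox (d := 4) (N * 2 ^ (j + 1))) ^ 2
      ≤ ν ^ 2 * energyNormW 2 (j + 1) (cavg 2 UB) X (periodBox (d := 4) (N * 2 ^ (j + 1))) ^ 2 := by
    have h0 := energyNormW_nonneg 2 (j + 1) (cavg 2 UB) XN (periodBox (d := 4) (N * 2 ^ (j + 1)))
    calc _ ≤ (ν * energyNormW 2 (j + 1) (cavg 2 UB) X (periodBox (d := 4) (N * 2 ^ (j + 1)))) ^ 2 := pow_le_pow_left₀ h0 hNw 2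
      _ = _ := by ring
  have hm := curlSq_ge_weighted (L := 2) (k := j + 1) hCP0 hP hXdec hXT hNw2
  -- (2) the plaquette radius along the segment, (3) the convexity letter
  have h1 : SmallField (vary (cavg 2 UB) X 1) (ε / (((2 : ℕ) : ℝ) ^ (j + 1)) ^ 2) := by
    rw [← hgauge]; exact smallField_gaugeAct hu hA.mem.1.2.2
  have hrad : ∀ t ∈ Icc (0 : ℝ) 1, SmallField (vary (cavg 2 UB) X t) (ε / (((2 : ℕ) : ℝ) ^ (j + 1)) ^ 2 + 7 * α ^ 2) := fun t ht =>
    smallField_vary_segment_class hWu hXs hWx h1 hXα ht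
  have ha' : 0 ≤ ε / (((2 : ℕ) : ℝ) ^ (j + 1)) ^ 2 + 7 * α ^ 2 := by positivity
  have hNM : 1 ≤ N * 2 ^ (j + 1) := Nat.mul_pos (by omega) (Nat.pow_pos (by norm_num))
  have hconv : ∀ t ∈ Icc (0 : ℝ) 1,
      ((((1 / 2 - ν ^ 2) / (2 * (1 + CP)) - ν ^ 2) / 2 - 576 * ((4 : ℕ) : ℝ) * (Real.exp α - 1) ^ 2 * (((2 : ℕ) : ℝ) ^ (j + 1)) ^ 2)
            / (Fintype.card n : ℝ)
          - 28 * ((4 : ℕ) : ℝ) * (ε / (((2 : ℕ) : ℝ) ^ (j + 1)) ^ 2 + 7 * α ^ 2) * (((2 : ℕ) : ℝ) ^ (j + 1)) ^ 2)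
          * energyNormW 2 (j + 1) (cavg 2 UB) X (periodBox (d := 4) (N * 2 ^ (j + 1))) ^ 2
        ≤ hess (vary (cavg 2 UB) X t) X X (perWin 4 (N * 2 ^ (j + 1))) := fun t ht =>
    hess_vary_ge_weighted (d := 4) (L := 2) (k := j + 1) (le_refl 1 |>.trans one_le_two) hNM hWu hXs hXP hα hXα hm ht ha' (hrad t ht)
  -- the k-free minorant `cK ≤ c_k` (card `n = 2`)
  have hck : cK ≤ ((((1 / 2 - ν ^ 2) / (2 * (1 + CP)) - ν ^ 2) / 2 - 576 * ((4 : ℕ) : ℝ) * (Real.exp α - 1) ^ 2 * (((2 : ℕ) : ℝ) ^ (j + 1)) ^ 2)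
            / (Fintype.card n : ℝ)
          - 28 * ((4 : ℕ) : ℝ) * (ε / (((2 : ℕ) : ℝ) ^ (j + 1)) ^ 2 + 7 * α ^ 2) * (((2 : ℕ) : ℝ) ^ (j + 1)) ^ 2) := by
    rw [hn, hcK, hQ]
    exact kfree_coercivity hCP0 hM1 hν hνle hα hαM
  -- (4) Taylor along the segment and (5) minimality of `U_A` against the admissible `W`
  obtain ⟨hd1, hd2⟩ := segment_derivData (cavg 2 UB) X (perWin 4 (N * 2 ^ (j + 1)))
  have htaylor := taylor_lower hd1 hd2 (fun t ht => (mul_le_mul_of_nonneg_right hck (sq_nonneg _)).trans (hconv t ht))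
  rw [T4AveragingDeficitWall.vary_zero] at htaylor
  have hmin : fineAction (vary (cavg 2 UB) X 1) (perWin 4 (N * 2 ^ (j + 1))) ≤ fineAction (cavg 2 UB) (perWin 4 (N * 2 ^ (j + 1))) := by
    have hle := hA.le (cavg 2 UB) hWadm
    rw [← levelAction_gaugeAct 2 N (j + 1) u UA, hgauge] at hle
    unfold levelAction at hle
    have hw : 0 < ((MinimalActionLevels.stepWt 4 2)⁻¹) ^ (j + 1) := pow_pos (inv_pos.mpr (stepWt_pos (d := 4) 2 (by norm_num))) _
    exact le_of_mul_le_mul_left hle hw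
  -- (6) the split of the first variation: the normal part's curl letter
  have hsplit : dAction (cavg 2 UB) X (perWin 4 (N * 2 ^ (j + 1)))
      = dAction (cavg 2 UB) XT (perWin 4 (N * 2 ^ (j + 1))) + dAction (cavg 2 UB) XN (perWin 4 (N * 2 ^ (j + 1))) := by
    conv_lhs => rw [hXdec]
    exact dAction_add _ _ _ _
  have hNpart : |dAction (cavg 2 UB) XN (perWin 4 (N * 2 ^ (j + 1)))| ≤ κ * energyNormW 2 (j + 1) (cavg 2 UB) X (periodBox (d := 4) (N * 2 ^ (j + 1))) ^ 2 :=
    (abs_dAction_le_radius_mul hWu hXN hWx (perWin 4 (N * 2 ^ (j + 1)))).trans hN1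
  -- (7)–(8) (RES♯) on the slice part, with the spike's weighted energy
  have hres := abs_dAction_le_of_regular_slice (n := n) (d := 4) (by norm_num) (le_refl 1 |>.trans one_le_two) hN j hb hbε hg hs2 hB' hreg'
    hWu hWPt hx hs1 hWx hXT
  obtain ⟨-, -, -, hfP, -⟩ := spike_tangent_data (N := N) (le_refl 1 |>.trans one_le_two) j hWu hWPt hx hs1 hWx hXT
  have hS2 := energyNormW_spike_sq_le (d := 4) (le_refl 1 |>.trans one_le_two) hN j hWu hWx hfP hframe
  have hES0 := energyNormW_nonneg 2 (j + 1) (cavg 2 UB) (gaugeDir (cavg 2 UB) (spikeW (2 ^ (j + 1)) (framePotW 2 (j + 1) (cavg 2 UB) XT)))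
      (periodBox (d := 4) (N * 2 ^ (j + 1)))
  have hET := energyNormW_sub_le 2 (j + 1) (cavg 2 UB) X XN (periodBox (d := 4) (N * 2 ^ (j + 1)))
  have hXTeq : XT = X - XN := eq_sub_of_add_eq hXdec.symm
  rw [← hXTeq] at hET
  have hρlow := residualScale_lower_d4 N j (b := b) hg.le
  have hρ0 := residualScale_nonneg 4 2 N b g (j + 1)
  -- ABSTRACT THE ATOMS and do the arithmetic with the pure real lemmas of §3b
  set M : ℝ := ((2 : ℕ) : ℝ) ^ (j + 1) with hM
  set E : ℝ := energyNormW 2 (j + 1) (cavg 2 UB) X (periodBox (d := 4) (N * 2 ^ (j + 1))) with hE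
  set ET : ℝ := energyNormW 2 (j + 1) (cavg 2 UB) XT (periodBox (d := 4) (N * 2 ^ (j + 1))) with hETdef
  set EN : ℝ := energyNormW 2 (j + 1) (cavg 2 UB) XN (periodBox (d := 4) (N * 2 ^ (j + 1))) with hENdef
  set ES : ℝ := energyNormW 2 (j + 1) (cavg 2 UB) (gaugeDir (cavg 2 UB) (spikeW (2 ^ (j + 1)) (framePotW 2 (j + 1) (cavg 2 UB) XT)))
      (periodBox (d := 4) (N * 2 ^ (j + 1))) with hESdef
  set ρ : ℝ := residualScale 4 2 N b g (j + 1) with hρ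
  set P : ℝ := (Fintype.card (T4AveragingDeficitWall.Plane 4) : ℝ) with hPdef
  have hP0' : 0 ≤ P := by rw [hPdef]; positivity
  -- `hres` in the abstract currency: `|dAction W X_T| ≤ C'ρ (ET + ES)`
  have hres' : |dAction (cavg 2 UB) XT (perWin 4 (N * 2 ^ (j + 1)))| ≤ C' * ρ * (ET + ES) := by rw [hC']; exact hres
  have hr0 : 0 ≤ C' * ρ := mul_nonneg hC'0 hρ0
  -- the spike's weighted energy: `ES ≤ σ·N²/M`
  have hESle : ES ≤ σ * ((N : ℝ) ^ 2 / M) := by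
    have h := spike_energy_le hES0 hG0 hM0 hP0' (by rw [hG]; exact hS2)
      (spike_coef_le hM1 hε.le hε1 hP0')
    rw [hσ, hPdef]; simpa only [mul_assoc] using h
  -- (9) the two-sided inequality `γ E² ≤ C'ρ(1+ν_c ε)·E + C'ρ·σ·N²/M`
  have hkey : dAction (cavg 2 UB) X (perWin 4 (N * 2 ^ (j + 1))) + cK * E ^ 2 / 2 ≤ 0 := by linarith only [htaylor, hmin]
  have hETle : ET ≤ (1 + νc * ε) * E := by
    have : EN ≤ νc * ε * E := hNw.trans (mul_le_mul_of_nonneg_right hνle hE0)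
    linarith only [hET, this]
  have hTpart : |dAction (cavg 2 UB) XT (perWin 4 (N * 2 ^ (j + 1)))| ≤ C' * ρ * ((1 + νc * ε) * E + σ * ((N : ℝ) ^ 2 / M)) :=
    hres'.trans (mul_le_mul_of_nonneg_left (by linarith only [hETle, hESle]) hr0)
  have hγE : γ * E ^ 2 ≤ C' * ρ * (1 + νc * ε) * E + C' * ρ * (σ * ((N : ℝ) ^ 2 / M)) := by
    rw [hγ]; exact two_sided_ineq hkey hsplit hNpart hTpart hκle
  -- (10) `N²/M ≤ 2ρ/w₀` and the final bookkeeping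
  have hNM' : (N : ℝ) ^ 2 / M ≤ 2 * ρ / w₀ := ratio_le_of_lower hM0 hw₀0 (by rw [hw₀]; exact hρlow)
  have hfinal : E ≤ Cfin * ρ := by
    rw [hCfin]
    exact rate_algebra hρ0 hγ0 hC'0 (by positivity) hσ0 hw₀0 (by positivity) hNM' hγE
  -- (11) the sup letter: `‖X(b)‖ ≤ α ≤ C_S ε / M = (C_S ε)·2^{−(j+1)}`
  have hsup : ∀ (x : Site 4) (κ' : Fin 4), ‖X x κ'‖ ≤ CS * ε * (((2 : ℕ) : ℝ)⁻¹) ^ (j + 1) := by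
    intro x κ'
    have hαle : α ≤ CS * ε / M := by rw [le_div_iff₀ hM0]; exact hαM
    have e : CS * ε * (((2 : ℕ) : ℝ)⁻¹) ^ (j + 1) = CS * ε / M := by rw [inv_pow, hM]; ring
    rw [e]; exact (hXα x κ').trans hαle
  exact ⟨u, X, hu, huP, hXs, hXP, hgauge, hfinal, hsup⟩

end

end Summit.QuantumFields.BalabanUV.T4Continuum.NE7EnergyRateWSU2
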